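import Literature.AlgebraicGeometry.Deformation.AbelianObstructionCoboundaryOfScaling
import Literature.AlgebraicGeometry.AbelianSchemes.AbelianVarietyCechH2MulTwoRaw
import HarnessLib

/-!
# The obstruction to lifting an abelian scheme over a principal small extension is a Čech coboundary (GAP-2 of MONO-G1, closed)

Layer `Literature/AlgebraicGeometry/Deformation`, namespace `Literature.AlgebraicGeometry.Deformation`.  THEOREMS ONLY; universe `0`.
Sequel of ★ `Deformation/AbelianObstructionCoboundaryOfScaling` (`exists_cechMD1_eq_of_abelian_datum_of_scaling`, GAP-2 modulo the
scaling relation `hrel₃`) fed by the PIN ★ `AbelianSchemes/AbelianVarietyCechH2MulTwoRaw` (`AbelianSchemeOver.cechMH2_mk_refine_comap_mulN_two`: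
`[2]^* = (2·2) •` on `Ȟ²(W, 𝒪)` of an abelian variety over a field of characteristic `0`, F0P1b-p04 (g2) over F0P1b-p01 (g2)'s N1 and
B-p14 (g21)'s N2): THE HYPOTHESIS-FREE CLOSER `exists_cechMD1_eq_of_abelian_datum` of the MONO-G1 socket `socket_GAP2_abelian_datum`
(F0P1b-p06 (g0) cert v3 ∕ F0P1c-p05 (g2) file of record `F11StubG1AbelianLift` v5b, socket :77 — consumed there BY NAME, 36 positional
binders).  Cell `hodgecm-mathlib` (D-0151 ∕ FLOOR 0), F-11 letter G1-P `stub_abelianLift`; count-neutral (`--supports stmt-HodgeConjecture-24835`);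
HC_CM is proved only modulo the 7 printed citations until rung 0 closes, and nothing here bears on it.

THE PRINT.  [Oort1971] §2.2 (Thm. 2.2.1 and its proof) ∕ [MumfordAV1970] §13 Cor. 2: abelian varieties are unobstructed — the obstruction
to lifting `A₀ / (A⧸J)` over the principal small extension `A → A⧸J` dies because `[2]^*` acts on `Ȟ²(𝒯) ⊗ J` both as `2` and as `4`;
[Hartshorne2010] Thm. 10.2 (proof) for the obstruction cochain of lifted gluing data.

## References
* [Oort1971] F. Oort, *Finite group schemes, local moduli for abelian varieties, and lifting problems*, Compositio Math. 23 (1971), §2.2.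
* [MumfordAV1970] D. Mumford, *Abelian Varieties* (1970), §13 Cor. 2.
* [Hartshorne2010] R. Hartshorne, *Deformation Theory*, GTM 257 (2010), Thm. 10.2 (proof), p. 81.
-/

noncomputable section

set_option backward.isDefEq.respectTransparency false

open CategoryTheory CategoryTheory.Limits AlgebraicGeometry Opposite TopologicalSpace
open scoped TensorProduct

namespace Literature.AlgebraicGeometry.Deformation

open Literature.AlgebraicGeometry.AbelianSchemes Literature.AlgebraicGeometry.Morphisms Literature.AlgebraicGeometry.Motives
  Literature.AlgebraicGeometry.Modules Literature.AlgebraicGeometry.HodgeTheory SmoothAffineDeformation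

set_option maxHeartbeats 1600000 in
/-- **GAP-2 for the abelian datum (hypothesis-free): the obstruction cochain of the lifted gluing data of `A₀ ×_{A⧸J} k` over the
principal small extension `A → A ⧸ J` is a Čech coboundary, `o = d¹γ`** — the MONO-G1 socket letter `socket_GAP2_abelian_datum`
VERBATIM (36 binders; ★ `exists_cechMD1_eq_of_abelian_datum_of_scaling` + the PIN ★ `AbelianSchemeOver.cechMH2_mk_refine_comap_mulN_two`).
[cite: Oort1971, §2.2 (Thm. 2.2.1 and its proof)] [cite: MumfordAV1970, §13 Cor. 2] [cite: Hartshorne2010, Thm. 10.2 (proof), p. 81] -/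
theorem exists_cechMD1_eq_of_abelian_datum
    {A : Type} [CommRing A] [Algebra ℚ A] [IsArtinianRing A] [IsLocalRing A] {k : Type} [Field k] [Algebra k A]
    (hk : Function.Surjective (⇑(IsLocalRing.residue A) ∘ ⇑(algebraMap k A)))
    {J : Ideal A} (hJ : J ≠ ⊤) (hmJ : IsLocalRing.maximalIdeal A * J = ⊥) (eJ : ↥(J.restrictScalars k) ≃ₗ[k] k)
    [IsArtinianRing (A ⧸ J)] [IsLocalRing (A ⧸ J)]
    (π' : (A ⧸ J) →ₐ[k] k) (hπ'nil : IsNilpotent (RingHom.ker π'))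
    (hπ'max : (RingHom.ker π').comap (Ideal.Quotient.mk J) = IsLocalRing.maximalIdeal A)
    (A₀ : AbelianSchemeOver (Spec (.of (A ⧸ J)))) {g : ℕ} (hA₀ : A₀.IsOfRelDim g)
    -- the CLOSED FIBRE, LITERALLY (★ p797210's witnesses): `X := (A₀.baseChange s).X`, `i₀ := pullback.fst A₀.X.hom s`,
    -- `s := Spec.map (CommRingCat.ofHom π'.toRingHom)` — an abelian variety over `k` of dimension `g` BY CONSTRUCTION
    [instΓ : ∀ W : (A₀.baseChange (Spec.map (CommRingCat.ofHom π'.toRingHom))).X.left.Opens, Algebra k Γ((A₀.baseChange (Spec.map (CommRingCat.ofHom π'.toRingHom))).X.left, W)]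
    (halg : ∀ (W : (A₀.baseChange (Spec.map (CommRingCat.ofHom π'.toRingHom))).X.left.Opens) (s : k), algebraMap k Γ((A₀.baseChange (Spec.map (CommRingCat.ofHom π'.toRingHom))).X.left, W) s = (constToPresheaf (A₀.baseChange (Spec.map (CommRingCat.ofHom π'.toRingHom))).X).app (op W) s)
    [instΓA : ∀ W : A₀.X.left.Opens, Algebra (A ⧸ J) Γ(A₀.X.left, W)]
    (halgA : ∀ (W : A₀.X.left.Opens) (a : A ⧸ J), algebraMap (A ⧸ J) Γ(A₀.X.left, W) a = (constToPresheaf A₀.X).app (op W) a)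
    {ι : Type} (U' : ι → A₀.X.left.affineOpens) (b' : (j l : ι) → Γ(A₀.X.left, (U' j).1))
    (hb' : ∀ j l, (U' j).1 ⊓ (U' l).1 = A₀.X.left.basicOpen (b' j l)) (hU'cov : IsOpenCover fun j => (U' j).1)
    (U : ι → (A₀.baseChange (Spec.map (CommRingCat.ofHom π'.toRingHom))).X.left.affineOpens) (hU : ∀ j, (U j).1 = (pullback.fst A₀.X.hom (Spec.map (CommRingCat.ofHom π'.toRingHom))) ⁻¹ᵁ (U' j).1)
    (b : (j l : ι) → Γ((A₀.baseChange (Spec.map (CommRingCat.ofHom π'.toRingHom))).X.left, (U j).1)) (hb : ∀ j l, (U j).1 ⊓ (U l).1 = (A₀.baseChange (Spec.map (CommRingCat.ofHom π'.toRingHom))).X.left.basicOpen (b j l))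
    -- ★ c2b chart data of `A₀.X` on the cover and their ties to `A₀.X`
    (e : ∀ j, (A ⧸ J) ⊗[k] Γ((A₀.baseChange (Spec.map (CommRingCat.ofHom π'.toRingHom))).X.left, (U j).1) ≃ₐ[A ⧸ J] Γ(A₀.X.left, (U' j).1))
    (ε₁ ε₂ : ∀ j l, (A ⧸ J) ⊗[k] Γ((A₀.baseChange (Spec.map (CommRingCat.ofHom π'.toRingHom))).X.left, (U j).1 ⊓ (U l).1) ≃ₐ[A ⧸ J] Γ(A₀.X.left, (U' j).1 ⊓ (U' l).1))
    (he : ∀ j x, (pullback.fst A₀.X.hom (Spec.map (CommRingCat.ofHom π'.toRingHom))).appLE (U' j).1 (U j).1 (hU j).le (e j x) = specialFibreHom π' _ x)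
    (hε₁ : ∀ j l (a : A ⧸ J) (s : Γ((A₀.baseChange (Spec.map (CommRingCat.ofHom π'.toRingHom))).X.left, (U j).1)),
      ε₁ j l (a ⊗ₜ (A₀.baseChange (Spec.map (CommRingCat.ofHom π'.toRingHom))).X.left.presheaf.map (homOfLE inf_le_left).op s) =
        A₀.X.left.presheaf.map (homOfLE inf_le_left).op (e j (a ⊗ₜ s)))
    (hε₂ : ∀ j l (a : A ⧸ J) (s : Γ((A₀.baseChange (Spec.map (CommRingCat.ofHom π'.toRingHom))).X.left, (U l).1)),
      ε₂ j l (a ⊗ₜ (A₀.baseChange (Spec.map (CommRingCat.ofHom π'.toRingHom))).X.left.presheaf.map (homOfLE inf_le_right).op s) =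
        A₀.X.left.presheaf.map (homOfLE inf_le_right).op (e l (a ⊗ₜ s)))
    (hε₁' : ∀ j l y, (pullback.fst A₀.X.hom (Spec.map (CommRingCat.ofHom π'.toRingHom))).appLE ((U' j).1 ⊓ (U' l).1) ((U j).1 ⊓ (U l).1)
        (by rw [hU, hU]; exact ((pullback.fst A₀.X.hom (Spec.map (CommRingCat.ofHom π'.toRingHom))).preimage_inf).ge) (ε₁ j l y) = specialFibreHom π' _ y)
    (hε₂' : ∀ j l y, (pullback.fst A₀.X.hom (Spec.map (CommRingCat.ofHom π'.toRingHom))).appLE ((U' j).1 ⊓ (U' l).1) ((U j).1 ⊓ (U l).1)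
        (by rw [hU, hU]; exact ((pullback.fst A₀.X.hom (Spec.map (CommRingCat.ofHom π'.toRingHom))).preimage_inf).ge) (ε₂ j l y) = specialFibreHom π' _ y)
    (hφ : ∀ j l x, transition (ε₁ j l) (ε₂ j l) x - x ∈
      (RingHom.ker π') • (⊤ : Submodule (A ⧸ J) ((A ⧸ J) ⊗[k] Γ((A₀.baseChange (Spec.map (CommRingCat.ofHom π'.toRingHom))).X.left, (U j).1 ⊓ (U l).1))))
    (hcocφ : ∀ (j l m : ι)
      (Φjl : (A ⧸ J) ⊗[k] Γ((A₀.baseChange (Spec.map (CommRingCat.ofHom π'.toRingHom))).X.left, (U j).1 ⊓ (U l).1) →ₐ[A ⧸ J] (A ⧸ J) ⊗[k] Γ((A₀.baseChange (Spec.map (CommRingCat.ofHom π'.toRingHom))).X.left, (U j).1 ⊓ (U l).1 ⊓ (U m).1))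
      (_ : ∀ a s, Φjl (a ⊗ₜ s) = a ⊗ₜ (A₀.baseChange (Spec.map (CommRingCat.ofHom π'.toRingHom))).X.left.presheaf.map (homOfLE inf_le_left).op s)
      (Φlm : (A ⧸ J) ⊗[k] Γ((A₀.baseChange (Spec.map (CommRingCat.ofHom π'.toRingHom))).X.left, (U l).1 ⊓ (U m).1) →ₐ[A ⧸ J] (A ⧸ J) ⊗[k] Γ((A₀.baseChange (Spec.map (CommRingCat.ofHom π'.toRingHom))).X.left, (U j).1 ⊓ (U l).1 ⊓ (U m).1))
      (_ : ∀ a s, Φlm (a ⊗ₜ s) = a ⊗ₜ (A₀.baseChange (Spec.map (CommRingCat.ofHom π'.toRingHom))).X.left.presheaf.map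
        (homOfLE (le_inf (inf_le_left.trans inf_le_right) inf_le_right)).op s)
      (Φjm : (A ⧸ J) ⊗[k] Γ((A₀.baseChange (Spec.map (CommRingCat.ofHom π'.toRingHom))).X.left, (U j).1 ⊓ (U m).1) →ₐ[A ⧸ J] (A ⧸ J) ⊗[k] Γ((A₀.baseChange (Spec.map (CommRingCat.ofHom π'.toRingHom))).X.left, (U j).1 ⊓ (U l).1 ⊓ (U m).1))
      (_ : ∀ a s, Φjm (a ⊗ₜ s) = a ⊗ₜ (A₀.baseChange (Spec.map (CommRingCat.ofHom π'.toRingHom))).X.left.presheaf.map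
        (homOfLE (le_inf (inf_le_left.trans inf_le_left) inf_le_right)).op s)
      (ρjl ρlm ρjm : (A ⧸ J) ⊗[k] Γ((A₀.baseChange (Spec.map (CommRingCat.ofHom π'.toRingHom))).X.left, (U j).1 ⊓ (U l).1 ⊓ (U m).1) ≃ₐ[A ⧸ J] (A ⧸ J) ⊗[k] Γ((A₀.baseChange (Spec.map (CommRingCat.ofHom π'.toRingHom))).X.left, (U j).1 ⊓ (U l).1 ⊓ (U m).1)),
      (∀ x, ρjl (Φjl x) = Φjl (transition (ε₁ j l) (ε₂ j l) x)) →
      (∀ x, ρlm (Φlm x) = Φlm (transition (ε₁ l m) (ε₂ l m) x)) →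
      (∀ x, ρjm (Φjm x) = Φjm (transition (ε₁ j m) (ε₂ j m) x)) → ρlm * ρjl = ρjm)
    -- ★ GAP-1 lifted data over `A`, reducing to `φ`
    (ψ : (j l : ι) → A ⊗[k] Γ((A₀.baseChange (Spec.map (CommRingCat.ofHom π'.toRingHom))).X.left, (U j).1 ⊓ (U l).1) ≃ₐ[A] A ⊗[k] Γ((A₀.baseChange (Spec.map (CommRingCat.ofHom π'.toRingHom))).X.left, (U j).1 ⊓ (U l).1))
    (hL : ∀ j l x, Algebra.TensorProduct.map (Ideal.Quotient.mkₐ k J) (AlgHom.id k Γ((A₀.baseChange (Spec.map (CommRingCat.ofHom π'.toRingHom))).X.left, (U j).1 ⊓ (U l).1)) (ψ j l x) =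
      transition (ε₁ j l) (ε₂ j l)
        (Algebra.TensorProduct.map (Ideal.Quotient.mkₐ k J) (AlgHom.id k Γ((A₀.baseChange (Spec.map (CommRingCat.ofHom π'.toRingHom))).X.left, (U j).1 ⊓ (U l).1)) x))
    (hψ : ∀ j l x, ψ j l x - x ∈
      ((RingHom.ker π').comap (Ideal.Quotient.mk J)) • (⊤ : Submodule A (A ⊗[k] Γ((A₀.baseChange (Spec.map (CommRingCat.ofHom π'.toRingHom))).X.left, (U j).1 ⊓ (U l).1))))
    (hcoc : ∀ (j l m : ι)
      (Φjl : A ⊗[k] Γ((A₀.baseChange (Spec.map (CommRingCat.ofHom π'.toRingHom))).X.left, (U j).1 ⊓ (U l).1) →ₐ[A] A ⊗[k] Γ((A₀.baseChange (Spec.map (CommRingCat.ofHom π'.toRingHom))).X.left, (U j).1 ⊓ (U l).1 ⊓ (U m).1))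
      (_ : ∀ a s, Φjl (a ⊗ₜ s) = a ⊗ₜ (A₀.baseChange (Spec.map (CommRingCat.ofHom π'.toRingHom))).X.left.presheaf.map (homOfLE inf_le_left).op s)
      (Φlm : A ⊗[k] Γ((A₀.baseChange (Spec.map (CommRingCat.ofHom π'.toRingHom))).X.left, (U l).1 ⊓ (U m).1) →ₐ[A] A ⊗[k] Γ((A₀.baseChange (Spec.map (CommRingCat.ofHom π'.toRingHom))).X.left, (U j).1 ⊓ (U l).1 ⊓ (U m).1))
      (_ : ∀ a s, Φlm (a ⊗ₜ s) = a ⊗ₜ (A₀.baseChange (Spec.map (CommRingCat.ofHom π'.toRingHom))).X.left.presheaf.map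
        (homOfLE (le_inf (inf_le_left.trans inf_le_right) inf_le_right)).op s)
      (Φjm : A ⊗[k] Γ((A₀.baseChange (Spec.map (CommRingCat.ofHom π'.toRingHom))).X.left, (U j).1 ⊓ (U m).1) →ₐ[A] A ⊗[k] Γ((A₀.baseChange (Spec.map (CommRingCat.ofHom π'.toRingHom))).X.left, (U j).1 ⊓ (U l).1 ⊓ (U m).1))
      (_ : ∀ a s, Φjm (a ⊗ₜ s) = a ⊗ₜ (A₀.baseChange (Spec.map (CommRingCat.ofHom π'.toRingHom))).X.left.presheaf.map
        (homOfLE (le_inf (inf_le_left.trans inf_le_left) inf_le_right)).op s)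
      (ρjl ρlm ρjm : A ⊗[k] Γ((A₀.baseChange (Spec.map (CommRingCat.ofHom π'.toRingHom))).X.left, (U j).1 ⊓ (U l).1 ⊓ (U m).1) ≃ₐ[A] A ⊗[k] Γ((A₀.baseChange (Spec.map (CommRingCat.ofHom π'.toRingHom))).X.left, (U j).1 ⊓ (U l).1 ⊓ (U m).1)),
      (∀ x, ρjl (Φjl x) = Φjl (ψ j l x)) → (∀ x, ρlm (Φlm x) = Φlm (ψ l m x)) →
      (∀ x, ρjm (Φjm x) = Φjm (ψ j m x)) →
      ∀ y, (ρlm * ρjl * ρjm⁻¹) y - y ∈ J • (⊤ : Submodule A (A ⊗[k] Γ((A₀.baseChange (Spec.map (CommRingCat.ofHom π'.toRingHom))).X.left, (U j).1 ⊓ (U l).1 ⊓ (U m).1))))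
    -- ★ F2 A obstruction cochain of `ψ` (coefficient line `eJ`)
    (o : CechMC2 (A₀.baseChange (Spec.map (CommRingCat.ofHom π'.toRingHom))).X.hom (tangentSheaf (A₀.baseChange (Spec.map (CommRingCat.ofHom π'.toRingHom))).X) (fun j => (U j).1))
    (ho : ∀ (j l m : ι)
      (Φjl : A ⊗[k] Γ((A₀.baseChange (Spec.map (CommRingCat.ofHom π'.toRingHom))).X.left, (U j).1 ⊓ (U l).1) →ₐ[A] A ⊗[k] Γ((A₀.baseChange (Spec.map (CommRingCat.ofHom π'.toRingHom))).X.left, (U j).1 ⊓ (U l).1 ⊓ (U m).1))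
      (_ : ∀ a s, Φjl (a ⊗ₜ s) = a ⊗ₜ (A₀.baseChange (Spec.map (CommRingCat.ofHom π'.toRingHom))).X.left.presheaf.map (homOfLE inf_le_left).op s)
      (Φlm : A ⊗[k] Γ((A₀.baseChange (Spec.map (CommRingCat.ofHom π'.toRingHom))).X.left, (U l).1 ⊓ (U m).1) →ₐ[A] A ⊗[k] Γ((A₀.baseChange (Spec.map (CommRingCat.ofHom π'.toRingHom))).X.left, (U j).1 ⊓ (U l).1 ⊓ (U m).1))
      (_ : ∀ a s, Φlm (a ⊗ₜ s) = a ⊗ₜ (A₀.baseChange (Spec.map (CommRingCat.ofHom π'.toRingHom))).X.left.presheaf.map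
        (homOfLE (le_inf (inf_le_left.trans inf_le_right) inf_le_right)).op s)
      (Φjm : A ⊗[k] Γ((A₀.baseChange (Spec.map (CommRingCat.ofHom π'.toRingHom))).X.left, (U j).1 ⊓ (U m).1) →ₐ[A] A ⊗[k] Γ((A₀.baseChange (Spec.map (CommRingCat.ofHom π'.toRingHom))).X.left, (U j).1 ⊓ (U l).1 ⊓ (U m).1))
      (_ : ∀ a s, Φjm (a ⊗ₜ s) = a ⊗ₜ (A₀.baseChange (Spec.map (CommRingCat.ofHom π'.toRingHom))).X.left.presheaf.map
        (homOfLE (le_inf (inf_le_left.trans inf_le_left) inf_le_right)).op s)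
      (ρjl ρlm ρjm : A ⊗[k] Γ((A₀.baseChange (Spec.map (CommRingCat.ofHom π'.toRingHom))).X.left, (U j).1 ⊓ (U l).1 ⊓ (U m).1) ≃ₐ[A] A ⊗[k] Γ((A₀.baseChange (Spec.map (CommRingCat.ofHom π'.toRingHom))).X.left, (U j).1 ⊓ (U l).1 ⊓ (U m).1)),
      (∀ x, ρjl (Φjl x) = Φjl (ψ j l x)) → (∀ x, ρlm (Φlm x) = Φlm (ψ l m x)) →
      (∀ x, ρjm (Φjm x) = Φjm (ψ j m x)) →
      ∀ c : Γ((A₀.baseChange (Spec.map (CommRingCat.ofHom π'.toRingHom))).X.left, (U j).1 ⊓ (U l).1 ⊓ (U m).1), (ρlm * ρjl * ρjm⁻¹) ((1 : A) ⊗ₜ c) =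
        (1 : A) ⊗ₜ c + ((eJ.symm 1 : ↥(J.restrictScalars k)) : A) ⊗ₜ
          (show Γ((A₀.baseChange (Spec.map (CommRingCat.ofHom π'.toRingHom))).X.left, (U j).1 ⊓ (U l).1 ⊓ (U m).1) from appLE (o j l m) (𝟙 _) (dSection (A₀.baseChange (Spec.map (CommRingCat.ofHom π'.toRingHom))).X _ c))) :
    ∃ γ : CechMC1 (A₀.baseChange (Spec.map (CommRingCat.ofHom π'.toRingHom))).X.hom (tangentSheaf (A₀.baseChange (Spec.map (CommRingCat.ofHom π'.toRingHom))).X) (fun j => (U j).1), cechMD1 (A₀.baseChange (Spec.map (CommRingCat.ofHom π'.toRingHom))).X.hom (tangentSheaf (A₀.baseChange (Spec.map (CommRingCat.ofHom π'.toRingHom))).X) (fun j => (U j).1) γ = o := by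
  -- `k ⊇ ℚ` (seam S1) for the PIN's `[CharZero k]`
  haveI : CharZero (IsLocalRing.ResidueField A) := charZero_of_injective_algebraMap (algebraMap ℚ _).injective
  haveI : CharZero k := ((IsLocalRing.residue A).comp (algebraMap k A)).charZero
  have hUtop : ⨆ j, (U j).1 = ⊤ := by
    have h' : ⨆ j, (U' j).1 = ⊤ := hU'cov
    simp_rw [hU]
    rw [← Scheme.Hom.preimage_iSup, h', Scheme.Hom.preimage_top]
  exact exists_cechMD1_eq_of_abelian_datum_of_scaling hk hJ hmJ eJ π' hπ'nil hπ'max A₀ hA₀ halg halgA U' b' hb' hU'cov U hU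
    b hb e ε₁ ε₂ he hε₁ hε₂ hε₁' hε₂' hφ hcocφ ψ hL hψ hcoc o ho
    (@fun z T W τ τ' a a' hWa hWa' => AbelianSchemeOver.cechMH2_mk_refine_comap_mulN_two (A₀.baseChange (Spec.map (CommRingCat.ofHom π'.toRingHom))) U hUtop z W τ τ'
      (fun s => (hWa s).le.trans ((A₀.baseChange (Spec.map (CommRingCat.ofHom π'.toRingHom))).X.left.basicOpen_le (a s)))
      (fun s => (hWa' s).le.trans ((A₀.baseChange (Spec.map (CommRingCat.ofHom π'.toRingHom))).X.left.basicOpen_le (a' s))))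

end Literature.AlgebraicGeometry.Deformation

end
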